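import Summits.CriticalPhenomena.SAWScalingLimit.Theses.SAWWeldingIdentification

/-!
# Assembly record `Assembly22` of route SAWWeldingIdentification (item stmt-CriticalPhenomena-6920)

The assembly-kind record `Assembly22` carries, verbatim, the type of the route's proved deciding
theorem `closes`:
`WeldingLawOfLimit → RemovableLimit → EventualTight → WeldingSetup → WeldingRigidity →
SLERemovableChord → IdentifyFromWelding → LimitUpgrade → ChordalSLE83Exists → SAWScalingLimit`.
It is therefore proved by the term `closes` (standard reductions: completion of the Dobrushin
domain to a conformal rectangle, Lusin–Souslin identification from the welding law, Prokhorov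
upgrade by eventual tightness — all carried out inside `closes`).

2026-08-16: the route decl `…Theses.SAWWeldingIdentification.Assembly22` was dropped from the
route file by the multi-assembly lint (the item stays recorded as proved by `assembly22_proof`);
the chain is therefore spelled out verbatim in `assembly22_chain_proof`, and the old name
`assembly22_proof` survives as a deprecated alias of it.
-/

namespace Summit.CriticalPhenomena.SAWScalingLimit.Theorems

open Summit.CriticalPhenomena.SAWScalingLimit.Theses.SAWWeldingIdentification in
/-- The hypothesis chain of the former assembly record `Assembly22` (item
stmt-CriticalPhenomena-6920) of route SAWWeldingIdentification, spelled out verbatim (the route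
decl was dropped 2026-08-16): it is the type of the route's deciding theorem `closes`, which proves
it outright (axioms: propext, Classical.choice, Quot.sound). [folklore] -/
theorem assembly22_chain_proof :
    WeldingLawOfLimit → RemovableLimit → EventualTight → WeldingSetup → WeldingRigidity →
      SLERemovableChord → IdentifyFromWelding → LimitUpgrade → ChordalSLE83Exists →
      _root_.SAWScalingLimit :=
  closes

/-- Deprecated name of `assembly22_chain_proof`: it proved the route decl
`Summit.CriticalPhenomena.SAWScalingLimit.Theses.SAWWeldingIdentification.Assembly22`
(stmt-CriticalPhenomena-6920) by name; that decl was dropped from the route file 2026-08-16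
(multi-assembly lint), so the statement is now carried, unfolded, by `assembly22_chain_proof`.
[folklore] -/
@[deprecated assembly22_chain_proof (since := "2026-08-16")]
alias assembly22_proof := assembly22_chain_proof

end Summit.CriticalPhenomena.SAWScalingLimit.Theorems
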